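import Literature.Probability.Percolation.QSMPolynomials
import Literature.Probability.Percolation.RussoFormula
import HarnessLib

/-!
# The Aizenman–Grimmett line argument for a two-class bond model (subgraph enhancement), abstractly

builds on p205010 (kernel theorem, internal audit signed; external expert review pending) — nothing in this file uses p205010.
Lane `prim-bschramm`, seat `prim-bschramm-p4` gen 10 (PART C3, tier 2′ of `P4-GENERAL.md`: the graph–subgraph strict inequality
for skeleton cylinders).  Helper file (`--supports stmt-CriticalPhenomena-4575 --as helper`).
Analytic layer of an essential-enhancement argument whose "enhancement" is a second class of EDGES: coordinates `K = K_E ⊔ K_V`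
(edges of a subgraph at density `p`, the other edges at density `s`), an increasing event `A`, the polynomial
`Θ(p, s) = Σ_{S ⊆ K, S ∈ A} ∏ w_i(S)` and the pivotal counts.  Unlike the tree's `Literature.….AGLine` (vertex marks, only
REMOVED by the local modification), the modification here may change the window coordinates in both directions, at the price
`ν₀` per coordinate when all parameters lie in `[ν₀, 1 − ν₀]`; the segment is therefore run at `s ∈ [s₀, 2s₀]`, `s₀ > 0`.
Contents: `SubAG.par/Theta/Piv`, `hasDerivAt_theta_line` (Russo along `t ↦ (p₀ − κt, t)`), `gW_le_of_window` (finite energy),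
`LocMod`, `piv_le`, `sum_piv_le` (the Aizenman–Grimmett inequality `Σ_e Piv_e ≤ C Σ_f Piv_f`), `theta_seg_mono` (integration on
`[t₀, t₁]`), `theta_mono_s/p`, `gTheta_eq_cylPoly` (the one-parameter endpoints are Russo's `cylPoly`).
References: Aizenman–Grimmett, J. Stat. Phys. 63 (1991); Martineau–Severo, Ann. Probab. 47 (2019) §6 (scheme followed here);
Balister–Bollobás–Riordan, arXiv:1402.0834 (bond case).
-/

noncomputable section

namespace Summit.CriticalPhenomena.PercolationContinuityZ3.Theorems.Transplant

namespace SubAG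

open Literature.Probability.Percolation Literature.Probability.Percolation.ProdWeight
open scoped Classical

variable {ι : Type*}

/-! ## §1 The two-parameter polynomials -/

/-- The parameter vector of the two-class model: `p` on the coordinates of `K_E`, `s` on all other coordinates.
[cite: MartineauSevero2019, §4 (ℙ_{p,s})] -/
def par (KE : Finset ι) (p s : ℝ) : ι → ℝ := fun i => if i ∈ KE then p else s

/-- Parameters in `[0,1]` coordinatewise. [folklore] -/
theorem par_mem {KE : Finset ι} {p s : ℝ} (hp : 0 ≤ p ∧ p ≤ 1) (hs : 0 ≤ s ∧ s ≤ 1) (i : ι) :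
    0 ≤ par KE p s i ∧ par KE p s i ≤ 1 := by
  unfold par; split_ifs; exacts [hp, hs]

/-- Parameters in `[ν₀, 1 − ν₀]` coordinatewise. [folklore] -/
theorem par_mem' {KE : Finset ι} {p s ν₀ : ℝ} (hp : ν₀ ≤ p ∧ p ≤ 1 - ν₀) (hs : ν₀ ≤ s ∧ s ≤ 1 - ν₀) (i : ι) :
    ν₀ ≤ par KE p s i ∧ par KE p s i ≤ 1 - ν₀ := by
  unfold par; split_ifs; exacts [hp, hs]

variable (KE KV : Finset ι) (A : Set (Set ι))

/-- **`Θ(p, s) = Σ_{S ⊆ K_E ∪ K_V, S ∈ A} ∏ w_i(S)`**, the finite-volume probability of `A` in the two-class model, as a polynomial.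
[cite: MartineauSevero2019, §6 (θ_L(p,s))] -/
def Theta (p s : ℝ) : ℝ := gTheta (KE ∪ KV) A (par KE p s)

/-- The weighted count of configurations in which the coordinate `i` is pivotal (`ℙ_{p,s}(i pivotal for A)`).
[cite: MartineauSevero2019, §6] -/
def Piv (p s : ℝ) (i : ι) : ℝ := gPiv (KE ∪ KV) A (par KE p s) i

variable {KE KV A}

/-- Pivotal counts are non-negative. [folklore] -/
theorem piv_nonneg {p s : ℝ} (hp : 0 ≤ p ∧ p ≤ 1) (hs : 0 ≤ s ∧ s ≤ 1) (i : ι) : 0 ≤ Piv KE KV A p s i :=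
  gPiv_nonneg _ _ (par_mem hp hs) i

/-- **Russo's formula along the line `t ↦ (p₀ − κt, t)`** (for disjoint classes): the derivative of `Θ` is
`−κ Σ_{e ∈ K_E} Piv_e + Σ_{f ∈ K_V} Piv_f`. [cite: MartineauSevero2019, §6 (Margulis–Russo formula along the segment)] -/
theorem hasDerivAt_theta_line (hA : IsUpperSet A) (hd : Disjoint KE KV) (p₀ κ t : ℝ) :
    HasDerivAt (fun t => Theta KE KV A (p₀ - κ * t) t)
      (-κ * ∑ e ∈ KE, Piv KE KV A (p₀ - κ * t) t e + ∑ f ∈ KV, Piv KE KV A (p₀ - κ * t) t f) t := by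
  have hq : ∀ i ∈ KE ∪ KV, HasDerivAt (fun t => par KE (p₀ - κ * t) t i) (if i ∈ KE then -κ else 1) t := by
    intro i _
    by_cases hi : i ∈ KE
    · simp only [par, hi, if_true]
      have := ((hasDerivAt_id t).const_mul κ).const_sub p₀
      simpa using this
    · simp only [par, hi, if_false]
      exact hasDerivAt_id t
  have h := ProdWeight.hasDerivAt_gTheta hA (KE ∪ KV) hq
  refine h.congr_deriv ?_
  rw [Finset.sum_union hd, Finset.mul_sum]
  congr 1
  · refine Finset.sum_congr rfl fun e he => ?_
    simp only [he, if_true, Piv, neg_mul]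
  · refine Finset.sum_congr rfl fun f hf => ?_
    have hf' : f ∉ KE := fun h => Finset.disjoint_left.1 hd h hf
    simp only [hf', if_false, one_mul, Piv]

/-! ## §2 Finite energy for a two-sided local modification -/

/-- **Finite energy.** If `S, S' ⊆ K` agree off the window `W` and every parameter lies in `[ν₀, 1 − ν₀]`, then
`ν₀^{|W|} W(S) ≤ W(S')`. [cite: MartineauSevero2019, §6 (Lemma 6.1 ⟹ (goal))] -/
theorem gW_le_of_window {q : ι → ℝ} {ν₀ : ℝ} (hν₀ : 0 ≤ ν₀) (hν1 : ν₀ ≤ 1) (K W : Finset ι)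
    (hq : ∀ i ∈ K, ν₀ ≤ q i ∧ q i ≤ 1 - ν₀) {S S' : Finset ι} (hoff : ∀ i ∈ K, i ∉ W → (i ∈ S ↔ i ∈ S')) :
    ν₀ ^ W.card * gW K q S ≤ gW K q S' := by
  set cc : ι → ℝ := fun i => if i ∈ W then ν₀ else 1 with hcc
  have hq01 : ∀ i ∈ K, 0 ≤ q i ∧ q i ≤ 1 := fun i hi => ⟨hν₀.trans (hq i hi).1, by linarith [(hq i hi).2]⟩
  have hgwt_ge : ∀ i ∈ K, ∀ T : Finset ι, ν₀ ≤ gwt q T i := fun i hi T => by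
    unfold gwt; split_ifs
    · exact (hq i hi).1
    · linarith [(hq i hi).2]
  have hgwt_le : ∀ i ∈ K, ∀ T : Finset ι, gwt q T i ≤ 1 := fun i hi T => by
    unfold gwt; split_ifs
    · linarith [(hq i hi).2]
    · linarith [(hq i hi).1]
  have hgwt_nn : ∀ i ∈ K, ∀ T : Finset ι, 0 ≤ gwt q T i := fun i hi T => hν₀.trans (hgwt_ge i hi T)
  have hfac : ∀ i ∈ K, cc i * gwt q S i ≤ gwt q S' i := by
    intro i hi
    by_cases hiW : i ∈ W
    · simp only [hcc, hiW, if_true]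
      calc ν₀ * gwt q S i ≤ ν₀ * 1 := mul_le_mul_of_nonneg_left (hgwt_le i hi S) hν₀
        _ ≤ gwt q S' i := by rw [mul_one]; exact hgwt_ge i hi S'
    · simp only [hcc, hiW, if_false, one_mul]
      have h := hoff i hi hiW
      unfold gwt
      by_cases h1 : i ∈ S
      · simp [h1, h.1 h1]
      · have h2 : i ∉ S' := fun x => h1 (h.2 x)
        simp [h1, h2]
  have hcc0 : ∀ i ∈ K, 0 ≤ cc i * gwt q S i := fun i hi =>
    mul_nonneg (by simp only [hcc]; split_ifs <;> linarith) (hgwt_nn i hi S)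
  have hprod : (∏ i ∈ K, cc i) * gW K q S ≤ gW K q S' := by
    unfold gW
    rw [← Finset.prod_mul_distrib]
    exact Finset.prod_le_prod hcc0 hfac
  have hcprod : ν₀ ^ W.card ≤ ∏ i ∈ K, cc i := by
    rw [Finset.prod_ite, Finset.prod_const_one, mul_one, Finset.prod_const]
    refine pow_le_pow_of_le_one hν₀ hν1 ?_
    exact Finset.card_le_card fun i hi => (Finset.mem_filter.1 hi).2
  have hWS : 0 ≤ gW K q S := Finset.prod_nonneg fun i hi => hgwt_nn i hi S
  calc ν₀ ^ W.card * gW K q S ≤ (∏ i ∈ K, cc i) * gW K q S := mul_le_mul_of_nonneg_right hcprod hWS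
    _ ≤ gW K q S' := hprod

/-! ## §3 From local modifications to the Aizenman–Grimmett inequality -/

section AG

variable (KE KV A)

/-- **The local modification property** for the two-class model: every `S ⊆ K` in which the `K_E`-coordinate `e` is pivotal admits
`S' ⊆ K` agreeing with `S` off the window `W e` in which some `f ∈ K_V ∩ W e` is pivotal.  (No sign restriction on the changes inside
the window.) [cite: MartineauSevero2019, Lemma 6.1] -/
def LocMod (W : ι → Finset ι) : Prop :=
  ∀ e ∈ KE, ∀ S ⊆ KE ∪ KV, IsPivotal A e (↑S : Set ι) →
    ∃ S' ⊆ KE ∪ KV, (∃ f ∈ KV, f ∈ W e ∧ IsPivotal A f (↑S' : Set ι)) ∧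
      ∀ i ∈ KE ∪ KV, i ∉ W e → (i ∈ S ↔ i ∈ S')

variable {KE KV A}

/-- **(goal), summed locally**: under `LocMod` with `|W e| ≤ N` and all parameters in `[ν₀, 1 − ν₀]`,
`Piv_e ≤ ν₀^{−N} 2^{N} Σ_{f ∈ K_V ∩ W e} Piv_f`. [cite: MartineauSevero2019, §6 (goal)] -/
theorem piv_le {W : ι → Finset ι} (hmod : LocMod KE KV A W) {N : ℕ} (hN : ∀ e ∈ KE, (W e).card ≤ N)
    {p s ν₀ : ℝ} (hν₀ : 0 < ν₀) (hν1 : ν₀ ≤ 1) (hp : ν₀ ≤ p ∧ p ≤ 1 - ν₀) (hs : ν₀ ≤ s ∧ s ≤ 1 - ν₀)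
    {e : ι} (he : e ∈ KE) :
    Piv KE KV A p s e ≤ (ν₀ ^ N)⁻¹ * 2 ^ N * ∑ f ∈ KV.filter (fun f => f ∈ W e), Piv KE KV A p s f := by
  set K := KE ∪ KV with hK
  set q := par KE p s with hq_def
  have hqν : ∀ i ∈ K, ν₀ ≤ q i ∧ q i ≤ 1 - ν₀ := fun i _ => par_mem' hp hs i
  have hq : ∀ i, 0 ≤ q i ∧ q i ≤ 1 := fun i =>
    par_mem ⟨hν₀.le.trans hp.1, by linarith [hp.2]⟩ ⟨hν₀.le.trans hs.1, by linarith [hs.2]⟩ i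
  set Loc : Finset ι := W e with hLoc
  set D : Finset (Finset ι) := K.powerset.filter fun S => IsPivotal A e (↑S : Set ι) with hD
  -- the modification map
  have hex : ∀ S ∈ D, ∃ S' : Finset ι, S' ⊆ K ∧ (∃ f ∈ KV, f ∈ W e ∧ IsPivotal A f (↑S' : Set ι)) ∧
      ν₀ ^ N * gW K q S ≤ gW K q S' ∧ S.filter (fun i => i ∉ Loc) = S'.filter (fun i => i ∉ Loc) := by
    intro S hS
    obtain ⟨hSK, hpiv⟩ := Finset.mem_filter.1 hS
    have hSK' : S ⊆ K := Finset.mem_powerset.1 hSK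
    obtain ⟨S', hS'K, hf, hoff⟩ := hmod e he S hSK' hpiv
    refine ⟨S', hS'K, hf, ?_, ?_⟩
    · have h1 := gW_le_of_window hν₀.le hν1 K (W e) hqν (S := S) (S' := S') hoff
      refine le_trans ?_ h1
      exact mul_le_mul_of_nonneg_right (pow_le_pow_of_le_one hν₀.le hν1 (hN e he)) (gW_nonneg K hq S)
    · ext i
      simp only [Finset.mem_filter]
      constructor
      · rintro ⟨hi, hiL⟩; exact ⟨(hoff i (hSK' hi) hiL).1 hi, hiL⟩
      · rintro ⟨hi, hiL⟩; exact ⟨(hoff i (hS'K hi) hiL).2 hi, hiL⟩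
  choose! Φ hΦK hΦpiv hΦw hΦoff using hex
  -- Step A: finite energy
  have hA : Piv KE KV A p s e ≤ (ν₀ ^ N)⁻¹ * ∑ S ∈ D, gW K q (Φ S) := by
    have hPiv : Piv KE KV A p s e = ∑ S ∈ D, gW K q S := by
      rw [Piv, gPiv, hD, Finset.sum_filter]
    rw [hPiv, Finset.mul_sum]
    refine Finset.sum_le_sum fun S hS => ?_
    have hμn : 0 < ν₀ ^ N := pow_pos hν₀ _
    rw [← div_le_iff₀' (inv_pos.2 hμn), div_inv_eq_mul, mul_comm]
    exact hΦw S hS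
  -- Step B: bounded fibres (`S` is determined by `Φ S` and `S ∩ Loc`)
  have hB : ∑ S ∈ D, gW K q (Φ S) ≤ 2 ^ N * ∑ S' ∈ D.image Φ, gW K q S' := by
    rw [Finset.sum_comp, Finset.mul_sum]
    refine Finset.sum_le_sum fun S' hS' => ?_
    rw [nsmul_eq_mul]
    refine mul_le_mul_of_nonneg_right ?_ (gW_nonneg K hq S')
    have hcard : (D.filter fun S => Φ S = S').card ≤ ((Loc.filter fun i => i ∈ K).powerset).card := by
      refine Finset.card_le_card_of_injOn (fun S => S.filter fun i => i ∈ Loc) ?_ ?_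
      · intro S hS
        simp only [Finset.coe_filter, Set.mem_setOf_eq] at hS
        have hSK : S ⊆ K := Finset.mem_powerset.1 (Finset.mem_filter.1 hS.1).1
        simp only [Finset.coe_powerset, Set.mem_preimage, Set.mem_powerset_iff, Finset.coe_subset]
        intro i hi
        rw [Finset.mem_filter] at hi ⊢
        exact ⟨hi.2, hSK hi.1⟩
      · intro S₁ hS₁ S₂ hS₂ hEq
        simp only [Finset.coe_filter, Set.mem_setOf_eq] at hS₁ hS₂
        have h1 := hΦoff S₁ hS₁.1
        have h2 := hΦoff S₂ hS₂.1
        rw [hS₁.2] at h1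
        rw [hS₂.2] at h2
        rw [← Finset.filter_union_filter_not_eq (fun i => i ∈ Loc) S₁,
          ← Finset.filter_union_filter_not_eq (fun i => i ∈ Loc) S₂]
        simp only at hEq
        rw [hEq, h1, ← h2]
    calc ((D.filter fun S => Φ S = S').card : ℝ) ≤ (((Loc.filter fun i => i ∈ K).powerset).card : ℝ) := by exact_mod_cast hcard
      _ = 2 ^ (Loc.filter fun i => i ∈ K).card := by rw [Finset.card_powerset]; push_cast; ring
      _ ≤ 2 ^ N := pow_le_pow_right₀ (by norm_num) ((Finset.card_le_card (Finset.filter_subset _ _)).trans (hN e he))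
  -- Step C: the images carry a pivotal `f ∈ K_V ∩ W e`
  set box := KV.filter (fun f => f ∈ W e) with hbox
  have hC : ∑ S' ∈ D.image Φ, gW K q S' ≤ ∑ f ∈ box, Piv KE KV A p s f := by
    set P : Finset ι → Prop := fun S' => ∃ f ∈ box, IsPivotal A f (↑S' : Set ι) with hP
    have hsub : D.image Φ ⊆ K.powerset.filter P := by
      intro S' hS'
      obtain ⟨S, hS, rfl⟩ := Finset.mem_image.1 hS'
      refine Finset.mem_filter.2 ⟨Finset.mem_powerset.2 (hΦK S hS), ?_⟩
      obtain ⟨f, hf, hfW, hpiv⟩ := hΦpiv S hS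
      exact ⟨f, Finset.mem_filter.2 ⟨hf, hfW⟩, hpiv⟩
    set g : Finset ι → ι → ℝ := fun S' f => if IsPivotal A f (↑S' : Set ι) then gW K q S' else 0 with hg
    have hg0 : ∀ S' f, 0 ≤ g S' f := fun S' f => by
      simp only [hg]; split_ifs; exacts [gW_nonneg K hq S', le_rfl]
    calc ∑ S' ∈ D.image Φ, gW K q S'
        ≤ ∑ S' ∈ K.powerset.filter P, gW K q S' :=
          Finset.sum_le_sum_of_subset_of_nonneg hsub fun S' _ _ => gW_nonneg K hq S'
      _ ≤ ∑ S' ∈ K.powerset.filter P, ∑ f ∈ box, g S' f := by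
          refine Finset.sum_le_sum fun S' hS' => ?_
          obtain ⟨-, f, hf, hpiv⟩ := Finset.mem_filter.1 hS'
          have hle : g S' f ≤ ∑ f' ∈ box, g S' f' := Finset.single_le_sum (f := g S') (fun f' _ => hg0 S' f') hf
          have hgy : g S' f = gW K q S' := by simp [hg, hpiv]
          rw [hgy] at hle
          exact hle
      _ ≤ ∑ S' ∈ K.powerset, ∑ f ∈ box, g S' f :=
          Finset.sum_le_sum_of_subset_of_nonneg (Finset.filter_subset _ _) fun S' _ _ => Finset.sum_nonneg fun f _ => hg0 S' f
      _ = ∑ f ∈ box, Piv KE KV A p s f := by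
          rw [Finset.sum_comm]
          rfl
  have hμinv : (0 : ℝ) ≤ (ν₀ ^ N)⁻¹ := inv_nonneg.2 (pow_nonneg hν₀.le _)
  calc Piv KE KV A p s e ≤ (ν₀ ^ N)⁻¹ * ∑ S ∈ D, gW K q (Φ S) := hA
    _ ≤ (ν₀ ^ N)⁻¹ * (2 ^ N * ∑ S' ∈ D.image Φ, gW K q S') := mul_le_mul_of_nonneg_left hB hμinv
    _ ≤ (ν₀ ^ N)⁻¹ * (2 ^ N * ∑ f ∈ box, Piv KE KV A p s f) :=
        mul_le_mul_of_nonneg_left (mul_le_mul_of_nonneg_left hC (by positivity)) hμinv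
    _ = _ := by ring

/-- The constant of the Aizenman–Grimmett inequality: `C = ν₀^{−N} · 2^{N} · N_M` (finite energy · fibre multiplicity · window overlap).
[cite: MartineauSevero2019, §6 ((goal) ⟹ (diffineq))] -/
def AGconst (N NM : ℕ) (ν₀ : ℝ) : ℝ := (ν₀ ^ N)⁻¹ * 2 ^ N * NM

/-- `0 ≤ AGconst`. [folklore] -/
theorem AGconst_nonneg (N NM : ℕ) {ν₀ : ℝ} (hν₀ : 0 ≤ ν₀) : 0 ≤ AGconst N NM ν₀ :=
  mul_nonneg (mul_nonneg (inv_nonneg.2 (pow_nonneg hν₀ _)) (by positivity)) (Nat.cast_nonneg _)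

/-- **The Aizenman–Grimmett inequality**: with the overlap bound `#{e ∈ K_E : f ∈ W e} ≤ N_M` for every `f`,
`Σ_{e ∈ K_E} Piv_e ≤ C · Σ_{f ∈ K_V} Piv_f`. [cite: MartineauSevero2019, §6 ((goal) ⟹ (diffineq))] -/
theorem sum_piv_le {W : ι → Finset ι} (hmod : LocMod KE KV A W) {N NM : ℕ} (hN : ∀ e ∈ KE, (W e).card ≤ N)
    (hNM : ∀ f ∈ KV, (KE.filter fun e => f ∈ W e).card ≤ NM)
    {p s ν₀ : ℝ} (hν₀ : 0 < ν₀) (hν1 : ν₀ ≤ 1) (hp : ν₀ ≤ p ∧ p ≤ 1 - ν₀) (hs : ν₀ ≤ s ∧ s ≤ 1 - ν₀) :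
    ∑ e ∈ KE, Piv KE KV A p s e ≤ AGconst N NM ν₀ * ∑ f ∈ KV, Piv KE KV A p s f := by
  set C₁ : ℝ := (ν₀ ^ N)⁻¹ * 2 ^ N with hC₁
  have hC₁0 : 0 ≤ C₁ := mul_nonneg (inv_nonneg.2 (pow_nonneg hν₀.le _)) (by positivity)
  have hp01 : 0 ≤ p ∧ p ≤ 1 := ⟨hν₀.le.trans hp.1, by linarith [hp.2]⟩
  have hs01 : 0 ≤ s ∧ s ≤ 1 := ⟨hν₀.le.trans hs.1, by linarith [hs.2]⟩
  have hPiv0 : ∀ f, 0 ≤ Piv KE KV A p s f := fun f => piv_nonneg hp01 hs01 f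
  calc ∑ e ∈ KE, Piv KE KV A p s e
      ≤ ∑ e ∈ KE, C₁ * ∑ f ∈ KV.filter (fun f => f ∈ W e), Piv KE KV A p s f :=
        Finset.sum_le_sum fun e he => piv_le hmod hN hν₀ hν1 hp hs he
    _ = C₁ * ∑ e ∈ KE, ∑ f ∈ KV, (if f ∈ W e then Piv KE KV A p s f else 0) := by
        rw [← Finset.mul_sum]
        refine congrArg (C₁ * ·) (Finset.sum_congr rfl fun e _ => ?_)
        rw [Finset.sum_filter]
    _ = C₁ * ∑ f ∈ KV, ∑ e ∈ KE, (if f ∈ W e then Piv KE KV A p s f else 0) := by rw [Finset.sum_comm]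
    _ = C₁ * ∑ f ∈ KV, ((KE.filter fun e => f ∈ W e).card : ℝ) * Piv KE KV A p s f := by
        refine congrArg (C₁ * ·) (Finset.sum_congr rfl fun f _ => ?_)
        rw [← Finset.sum_filter, Finset.sum_const, nsmul_eq_mul]
    _ ≤ C₁ * ∑ f ∈ KV, (NM : ℝ) * Piv KE KV A p s f := by
        refine mul_le_mul_of_nonneg_left (Finset.sum_le_sum fun f hf => ?_) hC₁0
        exact mul_le_mul_of_nonneg_right (by exact_mod_cast hNM f hf) (hPiv0 f)
    _ = AGconst N NM ν₀ * ∑ f ∈ KV, Piv KE KV A p s f := by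
        rw [← Finset.mul_sum, hC₁, AGconst]
        ring

end AG

/-! ## §4 Integration along the segment and monotonicity -/

section Line

/-- **Integration of the inequality along the segment `t ↦ (p₀ − κt, t)`, `t ∈ [t₀, t₁]`**: if `0 ≤ κ`, `κ · C ≤ 1`, and along the
segment all parameters stay in `[ν₀, 1 − ν₀]` (`ν₀ ≤ t₀`, `t₁ ≤ 1 − ν₀`, `ν₀ ≤ p₀ − κ t₁`, `p₀ − κ t₀ ≤ 1 − ν₀`), then
`Θ(p₀ − κ t₀, t₀) ≤ Θ(p₀ − κ t₁, t₁)`. [cite: MartineauSevero2019, §6 (the line segment argument)] -/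
theorem theta_seg_mono (hA : IsUpperSet A) (hd : Disjoint KE KV) {W : ι → Finset ι} (hmod : LocMod KE KV A W) {N NM : ℕ}
    (hN : ∀ e ∈ KE, (W e).card ≤ N) (hNM : ∀ f ∈ KV, (KE.filter fun e => f ∈ W e).card ≤ NM)
    {p₀ κ ν₀ t₀ t₁ : ℝ} (hν₀ : 0 < ν₀) (hν1 : ν₀ ≤ 1) (hκ0 : 0 ≤ κ) (hκ : κ * AGconst N NM ν₀ ≤ 1)
    (ht₀ : ν₀ ≤ t₀) (ht₀₁ : t₀ ≤ t₁) (ht₁ : t₁ ≤ 1 - ν₀) (hlo : ν₀ ≤ p₀ - κ * t₁) (hhi : p₀ - κ * t₀ ≤ 1 - ν₀) :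
    Theta KE KV A (p₀ - κ * t₀) t₀ ≤ Theta KE KV A (p₀ - κ * t₁) t₁ := by
  set F : ℝ → ℝ := fun t => Theta KE KV A (p₀ - κ * t) t with hF
  have hderiv := fun t => hasDerivAt_theta_line (KE := KE) (KV := KV) hA hd p₀ κ t
  have hmono : MonotoneOn F (Set.Icc t₀ t₁) := by
    refine monotoneOn_of_hasDerivWithinAt_nonneg (convex_Icc t₀ t₁)
      (fun t _ => (hderiv t).continuousAt.continuousWithinAt)
      (fun t _ => (hderiv t).hasDerivWithinAt) fun t ht => ?_
    rw [interior_Icc] at ht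
    have hp : ν₀ ≤ p₀ - κ * t ∧ p₀ - κ * t ≤ 1 - ν₀ :=
      ⟨hlo.trans (by nlinarith [ht.2.le, hκ0]), le_trans (by nlinarith [ht.1.le, hκ0]) hhi⟩
    have hs : ν₀ ≤ t ∧ t ≤ 1 - ν₀ := ⟨ht₀.trans ht.1.le, ht.2.le.trans ht₁⟩
    have hAG := sum_piv_le hmod hN hNM hν₀ hν1 hp hs
    have hB : 0 ≤ ∑ f ∈ KV, Piv KE KV A (p₀ - κ * t) t f :=
      Finset.sum_nonneg fun f _ => piv_nonneg ⟨hν₀.le.trans hp.1, by linarith [hp.2]⟩ ⟨hν₀.le.trans hs.1, by linarith [hs.2]⟩ _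
    have hC0 : 0 ≤ AGconst N NM ν₀ := AGconst_nonneg N NM hν₀.le
    nlinarith [hAG, hB, hκ, hκ0, mul_nonneg hκ0 hB]
  have h := hmono ⟨le_rfl, ht₀₁⟩ ⟨ht₀₁, le_rfl⟩ ht₀₁
  simpa [hF] using h

/-- **`Θ(p, s)` is non-decreasing in `s`** on `[0,1]`. [cite: MartineauSevero2019, §6 ("By monotonicity")] -/
theorem theta_mono_s (hA : IsUpperSet A) (hd : Disjoint KE KV) {p s s' : ℝ} (hp0 : 0 ≤ p) (hp1 : p ≤ 1) (hs0 : 0 ≤ s)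
    (hss' : s ≤ s') (hs'1 : s' ≤ 1) : Theta KE KV A p s ≤ Theta KE KV A p s' := by
  set F : ℝ → ℝ := fun t => Theta KE KV A (p - 0 * t) t with hF
  have hderiv := fun t => hasDerivAt_theta_line (KE := KE) (KV := KV) hA hd p 0 t
  have hmono : MonotoneOn F (Set.Icc 0 1) := by
    refine monotoneOn_of_hasDerivWithinAt_nonneg (convex_Icc 0 1)
      (fun t _ => (hderiv t).continuousAt.continuousWithinAt)
      (fun t _ => (hderiv t).hasDerivWithinAt) fun t ht => ?_
    rw [interior_Icc] at ht
    have hB : 0 ≤ ∑ f ∈ KV, Piv KE KV A (p - 0 * t) t f :=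
      Finset.sum_nonneg fun f _ => piv_nonneg ⟨by linarith, by linarith⟩ ⟨ht.1.le, ht.2.le⟩ _
    simpa using hB
  have h := hmono ⟨hs0, hss'.trans hs'1⟩ ⟨hs0.trans hss', hs'1⟩ hss'
  simpa [hF] using h

/-- Swapping the two classes swaps the two parameters. [folklore] -/
theorem theta_swap (hd : Disjoint KE KV) (p s : ℝ) : Theta KE KV A p s = Theta KV KE A s p := by
  unfold Theta gTheta
  rw [Finset.union_comm KV KE]
  refine Finset.sum_congr rfl fun S hS => ?_
  split_ifs with hSA
  · refine gW_congr _ (fun i hi => ?_) S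
    unfold par
    by_cases h1 : i ∈ KE
    · have h2 : i ∉ KV := fun x => Finset.disjoint_left.1 hd h1 x
      simp [h1, h2]
    · have h2 : i ∈ KV := (Finset.mem_union.1 hi).resolve_left h1
      simp [h1, h2]
  · rfl

/-- **`Θ(p, s)` is non-decreasing in `p`** on `[0,1]`. [cite: MartineauSevero2019, §6 ("By monotonicity")] -/
theorem theta_mono_p (hA : IsUpperSet A) (hd : Disjoint KE KV) {p p' s : ℝ} (hp0 : 0 ≤ p) (hpp' : p ≤ p') (hp'1 : p' ≤ 1)
    (hs0 : 0 ≤ s) (hs1 : s ≤ 1) : Theta KE KV A p s ≤ Theta KE KV A p' s := by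
  rw [theta_swap hd, theta_swap hd p']
  exact theta_mono_s hA hd.symm hs0 hs1 hp0 hpp' hp'1

end Line

/-! ## §5 The one-parameter endpoints -/

/-- **At parameters `r` on `u` and `0` off `u`, the weighted count is Russo's cylinder polynomial `cylPoly u K A r`** — the
`setBer(u, r)`-probability of `A` when `A` is determined by `K` (`Russo.measureReal_eq_cylPoly`). [cite: RussoZW1981, §4 Lemma 3 (proof)] -/
theorem gTheta_eq_cylPoly (K : Finset ι) (A : Set (Set ι)) (u : Set ι) (q : ι → ℝ) (r : ℝ)
    (h : ∀ i ∈ K, q i = if i ∈ u then r else 0) : gTheta K A q = Russo.cylPoly u K A r := by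
  unfold gTheta Russo.cylPoly
  refine Finset.sum_congr rfl fun S _ => ?_
  split_ifs with hSA
  · unfold gW
    refine Finset.prod_congr rfl fun i hi => ?_
    unfold gwt Russo.weight
    rw [h i hi]
    by_cases hiS : i ∈ S <;> by_cases hiu : i ∈ u <;> simp [hiS, hiu]
  · rfl

/-- `Θ(p, 0)` is the cylinder polynomial of `setBer(u, p)` whenever `u ∩ K = K_E` (the subgraph model: the `K_V`-edges are closed).
[cite: RussoZW1981, §4 Lemma 3 (proof)] -/
theorem theta_zero_eq_cylPoly (u : Set ι) (hu : ∀ i ∈ KE ∪ KV, i ∈ u ↔ i ∈ KE) (p : ℝ) :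
    Theta KE KV A p 0 = Russo.cylPoly u (KE ∪ KV) A p :=
  gTheta_eq_cylPoly _ _ u _ p fun i hi => by
    unfold par
    by_cases h1 : i ∈ KE
    · simp [h1, (hu i hi).2 h1]
    · have h2 : i ∉ u := fun x => h1 ((hu i hi).1 x)
      simp [h1, h2]

/-- `Θ(q, q)` is the cylinder polynomial of `setBer(u, q)` whenever `K ⊆ u` (the big graph at one density).
[cite: RussoZW1981, §4 Lemma 3 (proof)] -/
theorem theta_diag_eq_cylPoly (u : Set ι) (hu : ∀ i ∈ KE ∪ KV, i ∈ u) (q : ℝ) :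
    Theta KE KV A q q = Russo.cylPoly u (KE ∪ KV) A q :=
  gTheta_eq_cylPoly _ _ u _ q fun i hi => by
    unfold par
    simp [hu i hi]

end SubAG

end Summit.CriticalPhenomena.PercolationContinuityZ3.Theorems.Transplant

end
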